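import Summits.Parity.GeneralizedHardyLittlewood.Theses.LiouvilleShiftedTables
import Literature.NumberTheory.Sieve.DrappeauDispersion
import Literature.NumberTheory.Sieve.FouvryTenenbaumDivisorAP

/-!
# Vocabulary of the line `peel-to-drappeau` for the crux `TypeI2Dilated` (stmt-Parity-14272)

Route `LiouvilleShiftedTables` (Parity / GeneralizedHardyLittlewood), crux decl
`Summit.Parity.GeneralizedHardyLittlewood.Theses.LiouvilleShiftedTables.TypeI2Dilated` (rank 4): for `c ≠ 0`
there is `ρ > 0` with `∑_{q ≤ x^ρ} ∑_{r ≤ R} |∑_{s ≤ S} ∑_{n ≤ y/(sr), rsn ≡ w (q)} λ(rsn + c)| ≤ C x/(log x)^A`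
for `R ≤ x^ρ`, `S R ≤ x^{1/2+ρ}`, `y ≤ x`.

This is the DEFINITIONS file of the line (registered skeleton `Cruxes/TypeI2Dilated/Lines/peel-to-drappeau.lean`,
6 stubs on stmt-Parity-14272): the route-posited intermediate statements that the stubs prove and consume.
No theorem of substance lives here; every `def … : Prop` below is an OBLIGATION of the line (proved by a stub
file under `Theorems/`), except the two abbreviations of Literature named facts.

* `sRange c q r Slo S` — the smooth moduli `Slo < s ≤ S`, `(s, qr) = 1`, `(s, c) = 1`.
* `DrappeauTypeII` (abbrev of `Literature.NumberTheory.Sieve.Drappeau2017_theorem51`), `DilatedDivisorAP`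
  (abbrev of `FouvryTenenbaum2021_lemma412 ∧ FouvryTenenbaum2021_lemma413`), `LineFacts` (their conjunction):
  the printed engines, named facts — the crux closes MODULO them.
* `DilatedTypeIICore`, `DilatedTypeII` — Type II in crux coordinates (`𝔲_R`-form), without / with the
  hyperbolic window; `DilatedMainTerms` — the double-family Bombieri–Vinogradov mean value for `λ` with the
  small-conductor kernel `mainKernel` (P-indexed form); `classFilter`, `uRPiece`, `URBound` — the `𝔲_R` terms of
  the assembly, isolated (v6); `PeelStep`, `WindowStep`, `MainTermsStep`, `AssembleStep`, `AssembleFrom` — the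
  implication steps as named propositions (the types of the stubs); `peelStep_iff` — a vacuous anchor theorem
  (landing mechanics).

The idea, the proof plans and the Disproof constraints are recorded in the docstrings and in the skeleton's
module docstring. [this line: Ideas/peel-to-drappeau.md, Lines/peel-to-drappeau.md]
-/

noncomputable section

namespace Summit.Parity.GeneralizedHardyLittlewood.Cruxes.TypeI2Dilated.PeelToDrappeau

open Finset Real
open scoped ArithmeticFunction.sigma Classical
open Literature.NumberTheory.Sieve Literature.NumberTheory.Sieve.Drappeau2017
  Literature.NumberTheory.Sieve.FouvryTenenbaum2021
open Summit.Parity.GeneralizedHardyLittlewood.Theses.LiouvilleShiftedTables (TypeI2Dilated BVLiouville)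

/-! ### Vocabulary -/

/-- The `s`-range of the dispersion regime in crux coordinates: `Slo < s ≤ S` with `(s, q r) = 1`
(the `(qr)`-smooth part of `s` has been moved into `r`) and `(s, c) = 1` (the `c`-smooth part too),
so that `c` is a unit `mod s`. [folklore] -/
def sRange (c : ℤ) (q r : ℕ) (Slo S : ℝ) : Finset ℕ :=
  (Icc 1 ⌊S⌋₊).filter (fun s : ℕ => Slo < (s : ℝ) ∧ s.Coprime (q * r) ∧ IsCoprime (s : ℤ) c)

/-! ### The printed engines (Literature named facts, taken by name) -/

/-- **Drappeau 2017, Theorem 5.1** — the Literature named fact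
`Literature.NumberTheory.Sieve.Drappeau2017_theorem51` (hypothesis-free, power-saving
`𝔲_R`-dispersion for `∑_{s∼S,(s,a₁a₂)=1} ∑_{m∼M} ∑_{n∼N,(n,a₂)=1} α_m β_n 𝔲_{Rd}(mn ā₁ a₂; s)`), under the
line's registered name (an abbreviation, not a restatement: the fact is cited in its Literature file). -/
abbrev DrappeauTypeII : Prop :=
  Literature.NumberTheory.Sieve.Drappeau2017_theorem51

/-- The Type-I₂/I₃ input of the line: Fouvry–Tenenbaum 2021, Lemma 4.12 (4.16) and Lemma 4.13
(4.18) — `τ₂`, `τ₃` in arithmetic progressions beyond `√x` with unit classes `mod D` — the Literature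
named facts `FouvryTenenbaum2021_lemma412 ∧ FouvryTenenbaum2021_lemma413`, under the line's
registered name (an abbreviation; the facts are cited in their Literature file). -/
abbrev DilatedDivisorAP : Prop :=
  Literature.NumberTheory.Sieve.FouvryTenenbaum2021_lemma412 ∧
    Literature.NumberTheory.Sieve.FouvryTenenbaum2021_lemma413

/-- The two printed engines of the line as ONE registered obligation (`stub_facts`): Drappeau 2017
Thm 5.1 and Fouvry–Tenenbaum 2021 Lemmas 4.12–4.13, i.e. the Literature named facts
`Drappeau2017_theorem51 ∧ (FouvryTenenbaum2021_lemma412 ∧ FouvryTenenbaum2021_lemma413)`.  Deep published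
theorems: the crux closes MODULO them (conditional-result) until the facts are discharged (an abbreviation of the
conjunction; citations live in the two Literature files). -/
abbrev LineFacts : Prop :=
  DrappeauTypeII ∧ DilatedDivisorAP

/-! ### Crux-coordinate statements (the three nodes of the line) -/

/-- **Type II in crux coordinates, `𝔲_R`-form, WITHOUT the hyperbolic window** (conclusion of THE
PEEL, `stub_peel`; hypothesis of `stub_window`): exactly `DilatedTypeII` below with the window
condition `Ylo < mn ≤ Yhi` removed (full dyadic boxes `m ∼ M`, `n ∼ N`) and the stronger bound
`C x^{1+4ρ}/Rd` (per pair `(q, r)` the class twists `ξ mod L'` cost `φ(L') · φ(L')⁻¹ = 1`, the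
`g`- and `h`-splittings are divisor-bounded, so Theorem 5.1 gives `x^{1+o(1)}/Rd` per pair and
`x^{1+2ρ+o(1)}/Rd` in total).  All other data as in `DilatedTypeII`. [this line, conclusion of stub_peel] -/
def DilatedTypeIICore : Prop :=
  ∀ c : ℤ, c ≠ 0 → ∀ η : ℝ, 0 < η → η ≤ 1 / 12 → ∃ ρ₀ : ℝ, 0 < ρ₀ ∧ ∀ ρ : ℝ, 0 < ρ → ρ ≤ ρ₀ →
    ∀ K : ℝ, 0 ≤ K → ∃ C x₀ : ℝ, ∀ x : ℝ, x₀ ≤ x →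
    ∀ M N : ℝ, x ^ η ≤ N → N ≤ x ^ (1 / 3 - η) → x ^ (1 - ρ₀) ≤ M * N → M * N ≤ 256 * x →
    ∀ α β : ℕ → ℂ, (∀ m, ‖α m‖ ≤ (σ 0 m : ℝ) ^ K) → (∀ n, ‖β n‖ ≤ (σ 0 n : ℝ) ^ K) →
    ∀ u v : ℕ → ℤ, ∀ R Slo Rd : ℝ,
      R ≤ x ^ ρ → x ^ (1 / 2 - ρ₀) ≤ Slo → 2 * Slo * R ≤ x ^ (1 / 2 + ρ) → 1 ≤ Rd → Rd ≤ x ^ ρ₀ →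
      (∑ q ∈ Icc 1 ⌊x ^ ρ⌋₊, ∑ r ∈ Icc 1 ⌊R⌋₊,
        ‖∑ s ∈ sRange c q r Slo (2 * Slo), ∑ m ∈ BFI.dyadic M, ∑ n ∈ BFI.dyadic N,
            if ((m * n : ℕ) : ZMod r) = ((u r : ℤ) : ZMod r) ∧
                ((m * n : ℕ) : ZMod q) = ((v q : ℤ) : ZMod q) then
              α m * β n * uR Rd s (((m * n : ℕ) : ZMod s) * ((c : ZMod s))⁻¹)
            else 0‖) ≤
        C * x ^ (1 + 4 * ρ) / Rd

/-- **Type II in crux coordinates, `𝔲_R`-form** (conclusion of THE PEEL, `stub_peel`): for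
`c ≠ 0` and a window parameter `0 < η ≤ 1/12` there is `ρ₀ = ρ₀(c, η) > 0` such that for every
`0 < ρ ≤ ρ₀` and divisor exponent `K`, for `x ≥ x₀`: for all scales `x^η ≤ N ≤ x^{1/3−η}`,
`x^{1−ρ₀} ≤ MN ≤ 256 x`, all complex `α, β` with `|α_m| ≤ τ(m)^K`, `|β_n| ≤ τ(n)^K`, all class
functions `u, v : ℕ → ℤ` (class of the product `mn` modulo `r` and modulo the dilation `q`, one
class per modulus, arbitrary and possibly non-unit), every hyperbolic window `Ylo < mn ≤ Yhi`,
and every DYADIC block of smooth moduli `Slo < s ≤ 2 Slo` with `R ≤ x^ρ`, `Slo ≥ x^{1/2−ρ₀}`,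
`2 Slo R ≤ x^{1/2+ρ}`, `1 ≤ Rd ≤ x^{ρ₀}`:
`∑_{q ≤ x^ρ} ∑_{r ≤ R} ‖∑_{Slo < s ≤ 2Slo, (s, qrc)=1} ∑_{m∼M, n∼N, Ylo<mn≤Yhi} 1_{mn≡u_r (r)}
1_{mn≡v_q (q)} α_m β_n 𝔲_{Rd}(mn c̄; s)‖ ≤ C x^{1+5ρ}/Rd`.
The `s`-block is dyadic because Theorem 5.1 is (the `s`-sum sits INSIDE the norm, so sub-ranges
are not free); the side condition `(s, qrc) = 1` is Theorem 5.1's `(s, a₁a₂) = 1` with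
`a₁ := c·P`, `a₂ := g h·P`, `P = rad(qr)` (then `ā₁a₂ = c̄ g h` and `(n'', a₂) = 1` is
`(n'', qr) = 1`, enforced by splitting the `(qr)^∞`-part `h` of the `β`-variable).  Honest budget:
`#(q,r) ≤ x^{2ρ}` × (`x^{o(1)}` instances of Theorem 5.1 per pair, each `≤ C x (log x)^{c₀}/Rd`)
× (`O(log x)` Mellin weight for the window), plus the `h > x^{6ρ₀}` tail and the smooth-cutoff
edges `≤ x^{1−2ρ₀+o(1)} ≤ x^{1+5ρ}/Rd`.  With `Rd = x^{ρ₀}` and `ρ ≤ ρ₀/20` this is a power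
saving.  The `q = r = 1`, `u = v = 0` slice with a trivial window is Theorem 5.1 with `a₁ = c`,
`a₂ = 1`.
[this line, conclusion of stub_peel; cite: Drappeau2017, Thm 5.1 & Prop 5.3; FouvryTenenbaum2021, §4.3 (Mellin separation)] -/
def DilatedTypeII : Prop :=
  ∀ c : ℤ, c ≠ 0 → ∀ η : ℝ, 0 < η → η ≤ 1 / 12 → ∃ ρ₀ : ℝ, 0 < ρ₀ ∧ ∀ ρ : ℝ, 0 < ρ → ρ ≤ ρ₀ →
    ∀ K : ℝ, 0 ≤ K → ∃ C x₀ : ℝ, ∀ x : ℝ, x₀ ≤ x →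
    ∀ M N : ℝ, x ^ η ≤ N → N ≤ x ^ (1 / 3 - η) → x ^ (1 - ρ₀) ≤ M * N → M * N ≤ 256 * x →
    ∀ α β : ℕ → ℂ, (∀ m, ‖α m‖ ≤ (σ 0 m : ℝ) ^ K) → (∀ n, ‖β n‖ ≤ (σ 0 n : ℝ) ^ K) →
    ∀ u v : ℕ → ℤ, ∀ Ylo Yhi R Slo Rd : ℝ,
      R ≤ x ^ ρ → x ^ (1 / 2 - ρ₀) ≤ Slo → 2 * Slo * R ≤ x ^ (1 / 2 + ρ) → 1 ≤ Rd → Rd ≤ x ^ ρ₀ →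
      (∑ q ∈ Icc 1 ⌊x ^ ρ⌋₊, ∑ r ∈ Icc 1 ⌊R⌋₊,
        ‖∑ s ∈ sRange c q r Slo (2 * Slo), ∑ m ∈ BFI.dyadic M, ∑ n ∈ BFI.dyadic N,
            if Ylo < ((m * n : ℕ) : ℝ) ∧ ((m * n : ℕ) : ℝ) ≤ Yhi ∧
                ((m * n : ℕ) : ZMod r) = ((u r : ℤ) : ZMod r) ∧
                ((m * n : ℕ) : ZMod q) = ((v q : ℤ) : ZMod q) then
              α m * β n * uR Rd s (((m * n : ℕ) : ZMod s) * ((c : ZMod s))⁻¹)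
            else 0‖) ≤
        C * x ^ (1 + 5 * ρ) / Rd

/-- **Main terms in crux coordinates = the double-family Bombieri–Vinogradov mean value for `λ`**
(conclusion of `stub_mainTerms`; v4 form with the smooth-part index `P`, after the assembly audit of
2026-08-16: the `(qrc)`-smooth part `P` of `s` carries positive mass for classes with `gcd(s, q) ∣ w`, so the
`P`-sum must sit INSIDE the statement, outside the norm): for `c ≠ 0` there is `ρ₀ = ρ₀(c) > 0` such that for
every `0 < ρ ≤ ρ₀` and `A > 0`, for `x ≥ x₀`: for all class functions `u, v : ℕ → ℤ`, heights `Y ≤ 2x`, reals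
`R, Slo, S, Rd` and `Pm : ℕ` with `Pm · R ≤ x^ρ`, `S R ≤ x^{1/2+ρ}`, `1 ≤ Rd ≤ x^{ρ₀}`:
`∑_{P ≤ Pm} ∑_{q ≤ x^ρ} ∑_{r ≤ R} ‖∑_{s ∈ sRange c q (rP) (Slo/P) (S/P)} ∑_{m ≤ Y, m ≡ u_{rP} (rP), m ≡ v_q (q)}
λ(m) K_{Rd}(m c̄; s)‖ ≤ C x/(log x)^A`, where `K_{Rd}(t; s) = φ(s)⁻¹ ∑_{ψ mod s, cond ψ ≤ Rd} ψ(t)`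
(`mainKernel`), so `K_{Rd}(m c̄; s) = φ(s)⁻¹ ∑ ψ̄(c)ψ(m)`.  `Slo` is a free real (only `Slo/P < s` enters).
Trivial size `≍ x · Rd · (log x)^{O(1)}`, so the claim is a saving `Rd (log x)^{A+O(1)}`.  Proof plan (per
triple `(P, q, r̃ = rP)`, divisor-bounded multiplicities only): group `ψ` by its primitive `ψ* mod f | s`
(`(f, q r̃ c) = 1`); remove `(m, s) = 1` by Möbius over `d | s` (`d > D₀` trivially); class `e mod L = lcm(q, r̃)`:
`g = (e, L)`, `m = g m'`, unit class `mod L' = L/g` expanded in `ξ mod L'` (weight `φ(L')⁻¹`), `ξ → ξ*` (conductor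
`L''`, coprimality twist `(m', L') = 1`); the characters `χ = ψ*ξ*` are PRIMITIVE mod `f L''`
(`Literature.NumberTheory.LFunctions.isPrimitive_crtProd`): conductor `f L'' ≤ (log x)^B` → Siegel–Walfisz for
`λχ` (any class, via `SiegelWalfiszMoebius_holds.liouville_progression`); `f L'' > (log x)^B` → the Vaughan-type mean
value theorem for `λ` twisted by primitive characters (`moebius_character_meanValue` ported to `λ = 1_□ ⋆ μ`) in
dyadic blocks of `k = f L''`, saving `1/k`; the principal pieces are Bombieri–Vinogradov for `λ` over the moduli
`lcm(q, r̃)·d ≤ x^{2ρ}(log x)^C` (hypothesis `BVLiouville`, Cauchy–Schwarz over the multiplicity).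
[this line, conclusion of stub_mainTerms; cite: Vaughan1980; Drappeau2017, §6 (𝒮₁⁻); IwaniecKowalski2004, §17.1] -/
def DilatedMainTerms : Prop :=
  ∀ c : ℤ, c ≠ 0 → ∃ ρ₀ : ℝ, 0 < ρ₀ ∧ ∀ ρ : ℝ, 0 < ρ → ρ ≤ ρ₀ → ∀ A : ℝ, 0 < A →
    ∃ C x₀ : ℝ, ∀ x : ℝ, x₀ ≤ x → ∀ u v : ℕ → ℤ, ∀ Y R Slo S Rd : ℝ, ∀ Pm : ℕ,
      Y ≤ 2 * x → (Pm : ℝ) * R ≤ x ^ ρ → S * R ≤ x ^ (1 / 2 + ρ) → 1 ≤ Rd → Rd ≤ x ^ ρ₀ →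
      (∑ P ∈ Icc 1 Pm, ∑ q ∈ Icc 1 ⌊x ^ ρ⌋₊, ∑ r ∈ Icc 1 ⌊R⌋₊,
        ‖∑ s ∈ sRange c q (r * P) (Slo / P) (S / P),
            ∑ m ∈ (Icc 1 ⌊Y⌋₊).filter (fun m : ℕ =>
                (m : ZMod (r * P)) = ((u (r * P) : ℤ) : ZMod (r * P)) ∧
                  (m : ZMod q) = ((v q : ℤ) : ZMod q)),
              (ArithmeticFunction.liouville m : ℂ) *
                mainKernel Rd s ((m : ZMod s) * ((c : ZMod s))⁻¹)‖) ≤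
        C * x / Real.log x ^ A

/-! ### The dispersion (`𝔲_R`) side of the assembly, isolated (v6) -/

/-- The `m`-side class filter `{1 ≤ m ≤ Y : m ≡ c (mod r), m ≡ w + c (mod q)}` — the filter of
`DilatedMainTerms` / `DilatedTypeII` at the constant classes `u ≡ c`, `v ≡ w + c` that the crux produces
(`m = r s n + c`, `r s n ≡ w (q)`). [this line] -/
def classFilter (c : ℤ) (q w r : ℕ) (Y : ℝ) : Finset ℕ :=
  (Icc 1 ⌊Y⌋₊).filter (fun m : ℕ =>
    (m : ZMod r) = ((c : ℤ) : ZMod r) ∧ (m : ZMod q) = (((w : ℤ) + c : ℤ) : ZMod q))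

/-- The `𝔲_R`-piece `∑_{m ∈ classFilter c q w r Y} λ(m) 𝔲_{Rd}(m c̄; t)` of the kernel split
`1_{m ≡ c (t)} = mainKernel + uR` (Drappeau (5.1)) for one smooth modulus `t`. [this line] -/
def uRPiece (c : ℤ) (q w r t : ℕ) (Y Rd : ℝ) : ℂ :=
  ∑ m ∈ classFilter c q w r Y,
    (ArithmeticFunction.liouville m : ℂ) * uR Rd t ((m : ZMod t) * ((c : ZMod t))⁻¹)

/-- **The `𝔲_R` terms of the assembly** (v6 stub `stub_uRBound`; the analytic heart downstream of the peel:
`λ = 1_□ ⋆ μ`, Heath-Brown's identity for `μ` (`K = 4`), Drappeau's trichotomy — Type-II boxes by `DilatedTypeII`,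
Type-I_ℓ boxes (`ℓ = 2, 3`) by Fouvry–Tenenbaum Lemmas 4.12/4.13 (`DilatedDivisorAP`) plus Pólya–Vinogradov for
the subtracted characters, `ℓ = 1` by counting): for `c ≠ 0` there is `ρ₁ > 0` such that for `0 < ρ ≤ ρ₁`,
`x ≥ x₀`, every class `w`, height `Y ≤ 2x`, smooth-part index `P ≥ 1` with `P R ≤ x^{4ρ}`, and every dyadic
block of smooth moduli `(Slo, 2Slo]` with `x^{1/2−9ρ} ≤ Slo`, `2 Slo R P ≤ x^{1/2+ρ}`:
`∑_{q ≤ x^ρ} ∑_{r ≤ R} ‖∑_{s ∈ sRange c q (rP) Slo (2Slo)} ∑_{m ≤ Y, m ≡ c (rP), m ≡ w + c (q)} λ(m) 𝔲_{x^{40ρ}}(m c̄; s)‖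
≤ C x^{1−5ρ}` (conductor cut `Rd = x^{40ρ}`; statement fixed by the assembly worker's sub-skeleton, 2026-08-16).
[this line; cite: Drappeau2017, §6; FouvryTenenbaum2021, §§5, 7; Heathbrown1982] -/
def URBound : Prop :=
  DilatedTypeII → DilatedDivisorAP → ∀ c : ℤ, c ≠ 0 →
    ∃ ρ₁ : ℝ, 0 < ρ₁ ∧ ∀ ρ : ℝ, 0 < ρ → ρ ≤ ρ₁ → ∃ C x₀ : ℝ, ∀ x : ℝ, x₀ ≤ x →
      ∀ w : ℕ, ∀ Y R Slo : ℝ, ∀ P : ℕ, 1 ≤ P → Y ≤ 2 * x → (P : ℝ) * R ≤ x ^ (4 * ρ) →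
        x ^ (1 / 2 - 9 * ρ) ≤ Slo → 2 * Slo * R * P ≤ x ^ (1 / 2 + ρ) →
        (∑ q ∈ Icc 1 ⌊x ^ ρ⌋₊, ∑ r ∈ Icc 1 ⌊R⌋₊,
          ‖∑ s ∈ sRange c q (r * P) Slo (2 * Slo), uRPiece c q w (r * P) s Y (x ^ (40 * ρ))‖) ≤
          C * x ^ (1 - 5 * ρ)

/-! ### The three implication steps of the line, as named propositions

The skeleton audit (`#h21_check_skeleton`) takes as THE skeleton the unique theorem of this file whose
conclusion is the crux decl by name, admits as its hypotheses only registered obligations, and allows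
`sorry` only inside the declared `stub_*` theorems.  So the three implication stubs are typed by NAMED
propositions (`stub_assemble : AssembleStep` is then not itself read as "a theorem concluding the crux"),
and the composing theorem `TypeI2Dilated_of : TypeI2Dilated` applies the six stubs; its hypothetical form
(pure logic in the six stub statements) is recorded as an `example` next to it. -/

/-- THE PEEL as a named proposition: `DrappeauTypeII → DilatedTypeIICore` (the type of `stub_peel`):
purely arithmetic — CRT class `mod lcm(q, r)` → divisibility `g ∣ mn` × unit class in characters
`ξ mod L'` absorbed into the coefficients × rational residue, the `(qr)^∞`-part `h` of the `β`-variable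
split off (Rankin tail), scales checked against Theorem 5.1. [this line] -/
def PeelStep : Prop :=
  DrappeauTypeII → DilatedTypeIICore

/-- THE WINDOW as a named proposition: `DilatedTypeIICore → DilatedTypeII` (the type of `stub_window`):
separation of the hyperbolic window `Ylo < mn ≤ Yhi` at logarithmic cost — `1_{window}(mn) = ω(mn) + err`
with `ω(k) = ∑_{|j| ≤ J} c_j k^{iτ_j}` a finite Fourier series in `log k` (indicator ∗ Fejér kernel on a
circle of length `≍ log x`, transition width `x^{−3ρ₀}`, `∑_j |c_j| ≪ log x`), the twists `m^{iτ_j}`,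
`n^{iτ_j}` absorbed into `α, β` (same divisor bounds) so that `DilatedTypeIICore` applies to each `j`
with a UNIFORM bound, and `|err| ≤ 1_{two strips of relative width x^{−3ρ₀}}` bounded trivially by
`|𝔲_R(t; s)| ≤ 1_{t = 1} + Rd τ(s)/φ(s)` and divisor bounds: `x^{2ρ} · x^{1−3ρ₀+o(1)} Rd ≤ x^{1+5ρ}/Rd`.
A classical, self-contained tool (truncated Perron / Mellin separation in finite form). [this line] -/
def WindowStep : Prop :=
  DilatedTypeIICore → DilatedTypeII

/-- THE DOUBLE-FAMILY BV as a named proposition: `BVLiouville → DilatedMainTerms` (the type of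
`stub_mainTerms`). [this line] -/
def MainTermsStep : Prop :=
  Summit.Parity.GeneralizedHardyLittlewood.Theses.LiouvilleShiftedTables.BVLiouville → DilatedMainTerms

/-- THE ASSEMBLY as a named proposition:
`DilatedTypeII → DilatedMainTerms → DilatedDivisorAP → BVLiouville → TypeI2Dilated` (the type of
`stub_assemble`; named so that `stub_assemble` is not itself read as "a theorem concluding the crux" by
the audit — the composing theorem is `TypeI2Dilated_of`). [this line] -/
def AssembleStep : Prop :=
  DilatedTypeII → DilatedMainTerms → DilatedDivisorAP →
    Summit.Parity.GeneralizedHardyLittlewood.Theses.LiouvilleShiftedTables.BVLiouville →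
    Summit.Parity.GeneralizedHardyLittlewood.Theses.LiouvilleShiftedTables.TypeI2Dilated

/-- THE ASSEMBLY minus its analytic heart, as a named proposition: `URBound → AssembleStep` (the type of
`stub_assembleFrom`, v6): everything in the reduction of the crux to the four inputs EXCEPT the `𝔲_R` terms —
the cut at small `y`, `m := rsn + c`, the BV range via `BVLiouville` (Cauchy–Schwarz over the `τ₃`
multiplicity), the smooth/rough factorisation `s = P·s₃` with the Rankin tail `P > x^{3ρ}`, exact dyadic
`s₃`-blocks, the kernel split `1_{m ≡ c (s₃)} = mainKernel + uR`, the main terms via `DilatedMainTerms`. [this line] -/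
def AssembleFrom : Prop :=
  URBound → AssembleStep

/-- Anchor (A8 landing mechanics): the unfolding of the registered stub type `PeelStep`.  The Defs file proves this
registered sub-goal (`ledger workitem stub-add … --name peelStep_iff`) so that the vocabulary can land ahead of the
stub files that import it; mathematically vacuous. [this line] -/
theorem peelStep_iff : PeelStep ↔ (DrappeauTypeII → DilatedTypeIICore) := Iff.rfl

end Summit.Parity.GeneralizedHardyLittlewood.Cruxes.TypeI2Dilated.PeelToDrappeau

end
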